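import Summits.Ventures.HodgeRepro.Statements
import Summits.Ventures.HodgeRepro.FaceCensusRows8Proof
import Summits.Ventures.HodgeRepro.FaceCensusRow12Cyclic
import Summits.Ventures.HodgeRepro.FaceCensusRow12C6C2
import Summits.Ventures.HodgeRepro.FaceCensusRow12Dihedral
import Summits.Ventures.HodgeRepro.FaceCensusRow12Dicyclic
import Summits.Ventures.HodgeRepro.SexticCoordinatesProof

/-!
# RankFourFaceCensus — statement (a) of Statements.lean (seat p4)

`rankFourFaceCensus_holds : RankFourFaceCensus` assembles the degree-6 coordinate census and the eleven engine census
rows (orders 6, 8, 12).  Structural clauses by the generic theorems (no computation), dictionaries / orbit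
representatives / orbit sizes by kernel `decide`.
-/

namespace Summit.Ventures.HodgeRepro

/-- **(a) The rank-four face census for Galois CM fields of degree 6, 8 and 12** — the twelve conjuncts of
`RankFourFaceCensus` assembled by name. -/
theorem rankFourFaceCensus_holds : RankFourFaceCensus :=
  ⟨FaceCensus.Sextic.Coordinates.census, FaceCensus.Sextic.Cyclic.census,
    ⟨FaceCensus.Octic.Cyclic.census, FaceCensus.Octic.C4C2Square.census, FaceCensus.Octic.C4C2Nonsquare.census,
      FaceCensus.Octic.Triquadratic.census, FaceCensus.Octic.Dihedral.census, FaceCensus.Octic.Quaternion.census⟩,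
    ⟨FaceCensus.Duodecic.Cyclic.census, FaceCensus.Duodecic.C6C2.census, FaceCensus.Duodecic.Dihedral.census,
      FaceCensus.Duodecic.Dicyclic.census⟩⟩

end Summit.Ventures.HodgeRepro
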